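import Summits.NavierStokesRegularity.NavierStokesRegularity.Theorems.TypeILiouvilleTypeIliouvilleLOseenGauge
import Mathlib.MeasureTheory.Integral.Average
import HarnessLib

/-!
# The Oseen gauge theorem with the frame path exported (crux `TypeIliouvilleL` tooling;
# support of the W1 gauge story on ⟨stmt-NavierStokesRegularity-1222⟩)

Support file (theorems only, no definitions, no named facts). The tree's Oseen gauge theorem
`oseen_gauge_of_stronglyMeasurable` (file `TypeILiouvilleTypeIliouvilleLOseenGauge`) represents a
jointly strongly measurable bounded ancient mild solution `u` (duality form, `ν = 1`) at every
`t < 0` as `u(t) = v(t, · − A(t)) + c(t)` a.e. in space, with `v` one bounded continuous ancient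
solution of the Oseen integral equation and `A` a continuous frame path — but it hides the frame
path behind an existential: inside the proof `A(t) = ∫₀ᵗ 1_{(−∞,0)} b` is the primitive of the
parasitic drift `b` of KNSS 2009 Lemma 3.1 (stub A, `stub_weak_ancient_driftMild`), while the
statement only says `Continuous A`. For the regularity of the drift of CLASSICAL members of the
class (file `TypeILiouvilleTypeIliouvilleLInertialGaugeClassical`) one needs the link between `A`
and the exported constants `c`:

* `oseen_gauge_driftPath_of_stronglyMeasurable` — the same conclusion as
  `oseen_gauge_of_stronglyMeasurable`, PLUS: for all `s < t < 0`, `c` is interval integrable on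
  `[s, t]` and `A(t) − A(s) = ∫ₛᵗ c`.

## Proof

Re-run of the assembly of the landed stubs A, B, C, DE with the frame path kept explicit
(`oseen_of_driftMild_ancient_driftPath` = stub B `stub_driftMild_ancient_oseen` with the drift path
named, same proof over the public helpers of `TypeIliouvilleL.DriftMildAncientOseen`). The new
step: stub A gives `u(t) = U(t) + b(t)` a.e. in space for a.e. `t < 0`, stub DE gives
`u(t) = U(t) + c(t)` a.e. in space for every `t < 0` (`v(t, x − A t) = U(t, x)`), so `c = b` a.e. on
`(−∞, 0)` (two constants that agree a.e. on `ℝ³` agree), whence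
`A(t) − A(s) = ∫ₛᵗ 1_{(−∞,0)} b = ∫ₛᵗ c` (`driftPath_indicator_sub`).

## References

* G. Koch, N. Nadirashvili, G. Seregin, V. Šverák, *Liouville theorems for the Navier–Stokes
  equations and applications*, Acta Math. 203 (2009) 83–105 = arXiv:0709.3599, §1 p. 3
  (parasitic solutions `b(t)`, Galilean frames `y = x − ∫ b`), Lemma 3.1, §4 (i)–(ii).
  [KochNadirashviliSereginSverak2009]

WHAT THIS IS NOT: not a claim about NS regularity or about the Liouville conjecture (L).
-/

-- the summit and its single problem share the name (D-0017 nested layout)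
set_option linter.dupNamespace false

noncomputable section

open MeasureTheory Filter Set Function Metric
open scoped Topology ENNReal

namespace Summit.NavierStokesRegularity.NavierStokesRegularity.Theorems

namespace TypeIliouvilleL.OseenGaugeDriftPath

open Literature.Analysis Literature.Analysis.FluidPDE
open TypeIliouvilleL.DriftMildAncientOseen

/-- **The increment of the frame path is the integral of the drift**: for a measurable drift `b`
bounded on every window `(T, 0)` and `s ≤ t < 0`,
`driftPath (1_{(−∞,0)} b) t − driftPath (1_{(−∞,0)} b) s = ∫ₛᵗ b` (on `(s, t]` the truncation is
invisible). -/
theorem driftPath_indicator_sub {b : ℝ → EuclideanSpace ℝ (Fin 3)} (hbm : Measurable b)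
    (hloc : ∀ T : ℝ, T < 0 → ∃ N : ℝ, ∀ t ∈ Ioo T 0, ‖b t‖ ≤ N) {s t : ℝ} (hst : s ≤ t)
    (ht : t < 0) :
    driftPath (indicator (Iio 0) b) t - driftPath (indicator (Iio 0) b) s = ∫ τ in s..t, b τ := by
  have hi := intervalIntegrable_indicator hbm hloc
  simp only [driftPath]
  rw [intervalIntegral.integral_interval_sub_left (hi 0 t) (hi 0 s)]
  refine intervalIntegral.integral_congr_ae (Eventually.of_forall fun τ hτ => ?_)
  rw [uIoc_of_le hst] at hτ
  exact indicator_of_mem (show τ ∈ Iio (0 : ℝ) from hτ.2.trans_lt ht) _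

/-- **Stub B with the frame path named** (`stub_driftMild_ancient_oseen`, same proof): for an
ancient drift-mild pair `(U, b)` with local bounds and `A = driftPath (1_{(−∞,0)} b)`, the co-moving
field `V(t, y) = U(t, y + A(t))` is jointly measurable, continuous on the slab `(−∞,0) × ℝ³`, and
solves the Oseen integral equation `V(t) = e^{(t−s)Δ}V(s) − B¹_s(V,V)(t)` for all `s < t < 0`
(Galilean covariance of the drift-mild class on the windows `(s − 1, 0)`,
`IsKNSSDriftMild.galileanCovariance_R3`, read through
`IsKNSSDriftMild.eq_heatExtension_sub_oseenDuhamel_three`). -/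
theorem oseen_of_driftMild_ancient_driftPath
    {U : ℝ → EuclideanSpace ℝ (Fin 3) → EuclideanSpace ℝ (Fin 3)} {b : ℝ → EuclideanSpace ℝ (Fin 3)}
    (hUm : Measurable (uncurry U)) (hbm : Measurable b)
    (hcont : ContinuousOn (uncurry U) (Iio 0 ×ˢ univ))
    (hloc : ∀ T : ℝ, T < 0 → ∃ N : ℝ,
      (∀ t ∈ Ioo T 0, ∀ x, ‖U t x‖ ≤ N) ∧ ∀ t ∈ Ioo T 0, ‖b t‖ ≤ N)
    (hdiv : ∀ t < 0, IsWeaklyDivFree (U t))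
    (hmild : ∀ s t : ℝ, s < t → t < 0 → ∀ x,
      U t x = UnboundedOperators.heatExtension (U s) (t - s) x - driftDuhamel U b s t x)
    {A : ℝ → EuclideanSpace ℝ (Fin 3)} (hA : driftPath (indicator (Iio 0) b) = A) :
    Continuous A ∧
      Measurable (uncurry fun t y => U t (y + A t)) ∧
      ContinuousOn (uncurry fun t y => U t (y + A t)) (Iio 0 ×ˢ univ) ∧
      ∀ s t : ℝ, s < t → t < 0 → ∀ y,
        U t (y + A t) =
          UnboundedOperators.heatExtension (fun z => U s (z + A s)) (t - s) y -
            oseenDuhamel 1 s (fun τ z => U τ (z + A τ)) (fun τ z => U τ (z + A τ)) t y := by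
  have hlocb : ∀ T : ℝ, T < 0 → ∃ N : ℝ, ∀ t ∈ Ioo T 0, ‖b t‖ ≤ N := fun T hT => by
    obtain ⟨N, -, hN⟩ := hloc T hT
    exact ⟨N, hN⟩
  have hAc : Continuous A := by
    rw [← hA]
    exact continuous_driftPath_indicator hbm hlocb
  refine ⟨hAc, hUm.comp (measurable_fst.prodMk (measurable_snd.add
    (hAc.measurable.comp measurable_fst))), ?_, fun s t hst ht0 y => ?_⟩
  · -- joint continuity on the slab (composition with the shear `(t, y) ↦ (t, y + A t)`)
    have h : ContinuousOn (fun q : ℝ × EuclideanSpace ℝ (Fin 3) =>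
        uncurry U (q.1, q.2 + A q.1)) (Iio 0 ×ˢ univ) := by
      refine hcont.comp (continuous_fst.prodMk
        (continuous_snd.add (hAc.comp continuous_fst))).continuousOn ?_
      intro q hq
      exact mk_mem_prod hq.1 (mem_univ _)
    exact h
  · -- ## the Oseen identity in the co-moving frame (verbatim from stub B)
    set V : ℝ → EuclideanSpace ℝ (Fin 3) → EuclideanSpace ℝ (Fin 3) :=
      fun t y => U t (y + A t) with hV
    obtain ⟨T₀, hT₀⟩ : ∃ T₀ : ℝ, T₀ = s - 1 := ⟨_, rfl⟩
    have hT₀0 : T₀ < 0 := by linarith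
    obtain ⟨N, hNU, hNb⟩ := hloc T₀ hT₀0
    have hwin := driftMild_window hUm hbm hdiv hmild hT₀0 hNU hNb
    have hGal := IsKNSSDriftMild.galileanCovariance_R3 hwin
    have hs1 : 0 < s - T₀ := by linarith
    have hst' : s - T₀ < t - T₀ := by linarith
    have htT : t - T₀ < -T₀ := by linarith
    have key := (hGal.eq_heatExtension_sub_oseenDuhamel_three hs1 hst' htT).1 (y + A T₀)
    have hG : ∀ ρ : ℝ, 0 ≤ ρ →
        galileanShift (fun τ z => U (τ + T₀) z)
          (fun τ => indicator (Ioi T₀) (indicator (Iio 0) b) (τ + T₀)) ρ =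
          fun z => V (ρ + T₀) (z + -A T₀) := by
      intro ρ hρ
      funext z
      simp only [galileanShift_apply, hV]
      rw [driftPath_window hbm hlocb T₀ hρ, hA]
      congr 1
      abel
    have hVt : galileanShift (fun τ z => U (τ + T₀) z)
        (fun τ => indicator (Ioi T₀) (indicator (Iio 0) b) (τ + T₀)) (t - T₀) =
        fun z => V t (z + -A T₀) := by
      rw [hG (t - T₀) (by linarith), sub_add_cancel]
    have hVs : galileanShift (fun τ z => U (τ + T₀) z)
        (fun τ => indicator (Ioi T₀) (indicator (Iio 0) b) (τ + T₀)) (s - T₀) =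
        fun z => V s (z + -A T₀) := by
      rw [hG (s - T₀) hs1.le, sub_add_cancel]
    have hVτ : ∀ ρ ∈ Ioo (s - T₀) (t - T₀),
        galileanShift (fun τ z => U (τ + T₀) z)
          (fun τ => indicator (Ioi T₀) (indicator (Iio 0) b) (τ + T₀)) ρ =ᵐ[volume]
          (fun ρ z => V (ρ + T₀) (z + -A T₀)) ρ :=
      fun ρ hρ => Filter.EventuallyEq.of_eq (hG ρ (hs1.le.trans hρ.1.le))
    have hD : oseenDuhamel 1 (s - T₀)
        (galileanShift (fun τ z => U (τ + T₀) z)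
          (fun τ => indicator (Ioi T₀) (indicator (Iio 0) b) (τ + T₀)))
        (galileanShift (fun τ z => U (τ + T₀) z)
          (fun τ => indicator (Ioi T₀) (indicator (Iio 0) b) (τ + T₀))) (t - T₀) (y + A T₀) =
        oseenDuhamel 1 s V V t y := by
      have e1 : oseenDuhamel 1 (s - T₀) (fun ρ z => V (ρ + T₀) (z + -A T₀))
          (fun ρ z => V (ρ + T₀) (z + -A T₀)) (t - T₀) (y + A T₀) =
          oseenDuhamel 1 (s - T₀) (fun ρ => V (ρ + T₀)) (fun ρ => V (ρ + T₀)) (t - T₀)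
            (y + A T₀ + -A T₀) :=
        oseenDuhamel_comp_add_right 1 (s - T₀) (fun ρ => V (ρ + T₀)) (fun ρ => V (ρ + T₀))
          (-A T₀) (t - T₀) (y + A T₀)
      rw [oseenDuhamel_congr_ae_slice hVτ hVτ (y + A T₀), e1, oseenDuhamel_translate,
        sub_add_cancel, sub_add_cancel, add_neg_cancel_right]
    have hH : UnboundedOperators.heatExtension (fun z => V s (z + -A T₀)) (t - T₀ - (s - T₀))
        (y + A T₀) = UnboundedOperators.heatExtension (V s) (t - s) y := by
      rw [heatExtension_comp_add_right_apply (V s) (-A T₀), add_neg_cancel_right,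
        show t - T₀ - (s - T₀) = t - s by ring]
    rw [hVt, hVs, hD, hH] at key
    simp only [add_neg_cancel_right] at key
    simpa only [hV] using key

end TypeIliouvilleL.OseenGaugeDriftPath

open TypeIliouvilleL.OseenGaugeDriftPath TypeIliouvilleL.DriftMildAncientOseen
  Literature.Analysis.FluidPDE in
/-- **The Oseen gauge theorem with the frame path exported.** Every bounded ancient mild solution
of Navier–Stokes (`ν = 1`, duality form) on `ℝ³ × (−∞,0)` which is jointly strongly measurable is,
at every `t < 0` and a.e. in space, `x ↦ v(t, x − A(t)) + c(t)` for one field `v` which is jointly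
measurable, continuous and uniformly bounded on `(−∞,0) × ℝ³`, weakly divergence free on every
slice, and solves the Oseen integral equation for all `s < t < 0`; the frame path `A` is
continuous AND, for all `s < t < 0`, the constants `c` are interval integrable on `[s, t]` with
`A(t) − A(s) = ∫ₛᵗ c` (the frame path is the primitive of the parasitic drift of KNSS 2009 §1:
`A = ∫₀ 1_{(−∞,0)} b` with `b` the drift of Lemma 3.1, and `c = b` a.e. on `(−∞, 0)`). Same
assembly as `oseen_gauge_of_stronglyMeasurable` (stubs A, B — with the path named —, C, DE). -/
theorem oseen_gauge_driftPath_of_stronglyMeasurable :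
    ∀ u : ℝ → EuclideanSpace ℝ (Fin 3) → EuclideanSpace ℝ (Fin 3),
      Literature.Analysis.FluidPDE.IsBoundedAncientMildSolution 1 u →
      StronglyMeasurable (uncurry u) →
      ∃ (v : ℝ → EuclideanSpace ℝ (Fin 3) → EuclideanSpace ℝ (Fin 3))
        (A c : ℝ → EuclideanSpace ℝ (Fin 3)),
        Measurable (uncurry v) ∧ ContinuousOn (uncurry v) (Iio 0 ×ˢ univ) ∧
        (∃ K : ℝ, ∀ t < 0, ∀ x, ‖v t x‖ ≤ K) ∧
        (∀ t < 0, Literature.Analysis.FluidPDE.IsWeaklyDivFree (v t)) ∧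
        (∀ s t : ℝ, s < t → t < 0 → ∀ x,
          v t x = Literature.Analysis.UnboundedOperators.heatExtension (v s) (t - s) x -
            Literature.Analysis.FluidPDE.oseenDuhamel 1 s v v t x) ∧
        Continuous A ∧
        (∀ t < 0, u t =ᵐ[volume] fun x => v t (x - A t) + c t) ∧
        ∀ s t : ℝ, s < t → t < 0 →
          IntervalIntegrable c volume s t ∧ A t - A s = ∫ τ in s..t, c τ := by
  intro u hu hj
  obtain ⟨U, b, hUm, hbm, hUc, hloc, hUdiv, hUmild, hrepU⟩ := stub_weak_ancient_driftMild u hu hj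
  have hlocb : ∀ T : ℝ, T < 0 → ∃ N : ℝ, ∀ t ∈ Ioo T 0, ‖b t‖ ≤ N := fun T hT => by
    obtain ⟨N, -, hN⟩ := hloc T hT
    exact ⟨N, hN⟩
  -- ## the frame path, named
  obtain ⟨A, hA⟩ : ∃ A : ℝ → EuclideanSpace ℝ (Fin 3), driftPath (indicator (Iio 0) b) = A :=
    ⟨_, rfl⟩
  obtain ⟨hAc, hVm, hVc, hVmild⟩ :=
    oseen_of_driftMild_ancient_driftPath hUm hbm hUc hloc hUdiv hUmild hA
  set V : ℝ → EuclideanSpace ℝ (Fin 3) → EuclideanSpace ℝ (Fin 3) := fun t y => U t (y + A t)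
    with hV_def
  have hVdiv : ∀ t < 0, Literature.Analysis.FluidPDE.IsWeaklyDivFree (V t) := fun t ht =>
    (hUdiv t ht).comp_add_right' (A t)
  have hVmild' : ∀ s t : ℝ, s < t → t < 0 → ∀ y,
      V t y = Literature.Analysis.UnboundedOperators.heatExtension (V s) (t - s) y -
        Literature.Analysis.FluidPDE.oseenDuhamel 1 s V V t y :=
    fun s t hst ht y => hVmild s t hst ht y
  -- ## conservation of momentum for `V` (stub C)
  have hmom : ∀ s t : ℝ, s < t → t < 0 →
      Tendsto (fun R : ℝ => ⨍ y in Metric.ball (0 : EuclideanSpace ℝ (Fin 3)) R, (V t y - V s y))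
        atTop (𝓝 0) := by
    intro s t hst ht
    obtain ⟨N, hN, -⟩ := hloc (s - 1) (by linarith)
    have hb : ∀ σ ∈ Icc s t, ∀ y, ‖V σ y‖ ≤ N := fun σ hσ y =>
      hN σ ⟨by linarith [hσ.1], hσ.2.trans_lt ht⟩ (y + A σ)
    have key := stub_oseen_ball_average_momentum V N s t hst hVm hb
    have heq : (fun R : ℝ => ⨍ y in Metric.ball (0 : EuclideanSpace ℝ (Fin 3)) R, (V t y - V s y)) =
        fun R : ℝ => ⨍ y in Metric.ball (0 : EuclideanSpace ℝ (Fin 3)) R,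
          (Literature.Analysis.UnboundedOperators.heatExtension (V s) (t - s) y - V s y -
            Literature.Analysis.FluidPDE.oseenDuhamel 1 s V V t y) := by
      funext R
      congr 1
      funext y
      rw [hVmild' s t hst ht y]
      abel
    rw [heq]
    exact key
  -- ## the a.e.-in-time representation through `V`
  have hrepV : ∀ᵐ t ∂(volume.restrict (Iio (0 : ℝ))),
      u t =ᵐ[volume] fun x => V t (x - A t) + b t := by
    filter_upwards [hrepU] with t ht
    refine ht.trans (Eventually.of_forall fun x => ?_)
    simp only [hV_def, sub_add_cancel]
  have hslice : ∀ t < 0, AEStronglyMeasurable (u t) volume := fun t _ =>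
    (hj.comp_measurable measurable_prodMk_left).aestronglyMeasurable
  -- ## stub DE: one bound, every slice
  obtain ⟨⟨K, hK⟩, c, hc⟩ :=
    stub_oseen_gauge_uniform_every_slice u V A b hu hslice hAc hVc hVdiv hmom hrepV
  -- ## NEW: `c = b` a.e. on `(−∞, 0)`
  have hcb : ∀ᵐ t ∂(volume.restrict (Iio (0 : ℝ))), c t = b t := by
    filter_upwards [hrepV, ae_restrict_mem measurableSet_Iio] with t h1 h2
    have h3 := hc t h2
    have h4 : ∀ᵐ x ∂(volume : Measure (EuclideanSpace ℝ (Fin 3))),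
        V t (x - A t) + b t = V t (x - A t) + c t := by
      filter_upwards [h1, h3] with x hx1 hx3
      rw [← hx1, ← hx3]
    obtain ⟨x, hx⟩ := h4.exists
    exact (add_left_cancel hx).symm
  have hcb' : ∀ᵐ t ∂(volume : Measure ℝ), t ∈ Iio (0 : ℝ) → c t = b t :=
    (ae_restrict_iff' measurableSet_Iio).1 hcb
  refine ⟨V, A, c, hVm, hVc, ⟨K, hK⟩, hVdiv, hVmild', hAc, hc, fun s t hst ht => ?_⟩
  -- ## the increment of the frame path
  have hsub : Set.uIoc s t ⊆ Iio 0 := fun τ hτ => by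
    rw [uIoc_of_le hst.le] at hτ
    exact (hτ.2.trans_lt ht : τ < 0)
  have hae : ∀ᵐ τ ∂(volume : Measure ℝ), τ ∈ Set.uIoc s t → b τ = c τ := by
    filter_upwards [hcb'] with τ hτ hτm
    exact (hτ (hsub hτm)).symm
  have hib : IntervalIntegrable b volume s t :=
    (intervalIntegrable_indicator hbm hlocb s t).congr fun τ hτ => indicator_of_mem (hsub hτ) _
  refine ⟨hib.congr_ae ((ae_restrict_iff' measurableSet_uIoc).2 hae), ?_⟩
  rw [← hA, driftPath_indicator_sub hbm hlocb hst.le ht]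
  exact intervalIntegral.integral_congr_ae hae

end Summit.NavierStokesRegularity.NavierStokesRegularity.Theorems

end
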